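import Literature.MathematicalPhysics.KineticTheory.ZeroWavenumberSpace
import HarnessLib

/-!
# Zero-wavenumber parity of pair classes (lead note for stub `stub_oddSectorMourreEstimate`)

Crux stmt-AtomisticToContinuum-12594 (`EmbeddedDrudeMourre.MourreDissolution`), line
`separable-vertex-faddeev-pair-sector`. A by-product of the lead's analysis of the reflection-odd sector
`ℋ₀^{ι−}` on which the registered Mourre estimate is posed: in Doyon's zero-wavenumber space `ℋ₀`
translations act trivially, hence the class of a translated pair is symmetric under the sign of the
separation,

  `[a · (b ∘ τ_y)] = [(a ∘ τ_{-y}) · b]`, in particular `[a · (a ∘ τ_y)] = [a · (a ∘ τ_{-y})]`,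

so every "odd two-field" combination `Σ_y c(y) [a · (a ∘ τ_y)]` with `c(-y) = -c(y)` VANISHES in `ℋ₀`:
the reflection-odd sector contains no two-field hydrodynamic class built from one density (the channel
to which a `t^{-3/2}` tail / `|ω|^{1/2}` cusp is usually attributed); the first ι-odd purely
hydrodynamic classes are three-field. Stated for a general `FluctuationStructure` over `(ℤ, count)`
with the chain shift, i.e. for every `ZeroWavenumberData`.
-/

noncomputable section

namespace Summit.AtomisticToContinuum.FouriersLaw.Theorems.MourreDissolution

open MeasureTheory Function
open Literature.MathematicalPhysics.KineticTheory
open Literature.MathematicalPhysics.KineticTheory.HeatConduction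

variable (F : FluctuationStructure (Measure.count : Measure ℤ) chainShift)

/-- Pointwise identity: translating the product `a · (b ∘ τ_y)` by `-y` gives `(a ∘ τ_{-y}) · b`.
[folklore] -/
theorem mul_comp_chainShift_comp_neg (a b : ChainConfig → ℝ) (y : ℤ) :
    (a * (b ∘ chainShift y)) ∘ chainShift (-y) = (a ∘ chainShift (-y)) * b := by
  funext σ
  simp only [comp_apply, Pi.mul_apply]
  congr 1
  exact congrArg b (show (chainShift y ∘ chainShift (-y)) σ = σ by rw [ShiftAction.comp_neg]; rfl)

/-- **Pair classes are symmetric in the separation**: `[a · (b ∘ τ_y)] = [(a ∘ τ_{-y}) · b]` in `ℋ₀`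
whenever the product is a local observable (translations act trivially on `ℋ₀`,
`FluctuationStructure.fluct_comp_shift`). [folklore] -/
theorem fluct_mul_comp_chainShift {a b : ChainConfig → ℝ} {y : ℤ}
    (h : a * (b ∘ chainShift y) ∈ F.localObs) :
    F.fluct (a * (b ∘ chainShift y)) = F.fluct ((a ∘ chainShift (-y)) * b) := by
  rw [← mul_comp_chainShift_comp_neg, F.fluct_comp_shift (-y) h]

/-- **Zero-wavenumber parity of one-density pair classes**: `[a · (a ∘ τ_y)] = [a · (a ∘ τ_{-y})]`.
[folklore] -/
theorem fluct_mul_self_comp_chainShift {a : ChainConfig → ℝ} {y : ℤ}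
    (h : a * (a ∘ chainShift y) ∈ F.localObs) :
    F.fluct (a * (a ∘ chainShift y)) = F.fluct (a * (a ∘ chainShift (-y))) := by
  rw [fluct_mul_comp_chainShift F h, mul_comm]

/-- **Odd two-field combinations vanish in `ℋ₀`** (registered helper stub `oddPairClasses_vanish` of
crux stmt-AtomisticToContinuum-12594): for every zero-wavenumber fluctuation structure of the chain, a
weight `c` with `c (-y) = -c y` on a finite symmetric index set `s`, and an observable `a` whose translated
pair products are local observables, `Σ_{y ∈ s} c(y) • [a · (a ∘ τ_y)] = 0`. [folklore] -/
theorem oddPairClasses_vanish : ∀ (F : Literature.MathematicalPhysics.KineticTheory.FluctuationStructure (MeasureTheory.Measure.count : MeasureTheory.Measure ℤ) Literature.MathematicalPhysics.KineticTheory.HeatConduction.chainShift) (a : Literature.MathematicalPhysics.KineticTheory.HeatConduction.ChainConfig → ℝ) (s : Finset ℤ) (c : ℤ → ℝ), (∀ y ∈ s, -y ∈ s) → (∀ y : ℤ, c (-y) = -c y) → (∀ y ∈ s, a * (a ∘ Literature.MathematicalPhysics.KineticTheory.HeatConduction.chainShift y) ∈ F.localObs) → ∑ y ∈ s, c y • F.fluct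 (a * (a ∘ Literature.MathematicalPhysics.KineticTheory.HeatConduction.chainShift y)) = 0 := by
  intro F a s c hs hc h
  -- pair `y` with `-y`: the sum equals its own negative
  have key : ∑ y ∈ s, c y • F.fluct (a * (a ∘ chainShift y)) =
      -∑ y ∈ s, c y • F.fluct (a * (a ∘ chainShift y)) := by
    calc ∑ y ∈ s, c y • F.fluct (a * (a ∘ chainShift y))
        = ∑ y ∈ s, c (-y) • F.fluct (a * (a ∘ chainShift (-y))) :=
          (Finset.sum_nbij' (fun y => -y) (fun y => -y) (by simpa using hs) (by simpa using hs)
            (fun y _ => neg_neg y) (fun y _ => neg_neg y) (fun y _ => rfl)).symm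
      _ = ∑ y ∈ s, -(c y • F.fluct (a * (a ∘ chainShift y))) := by
          refine Finset.sum_congr rfl fun y hy => ?_
          rw [hc y, neg_smul, ← fluct_mul_self_comp_chainShift F (h y hy)]
      _ = -∑ y ∈ s, c y • F.fluct (a * (a ∘ chainShift y)) := Finset.sum_neg_distrib _
  have h2 : (2 : ℝ) • ∑ y ∈ s, c y • F.fluct (a * (a ∘ chainShift y)) = 0 := by
    rw [two_smul]
    nth_rewrite 2 [key]
    exact add_neg_cancel _
  exact (smul_eq_zero.1 h2).resolve_left two_ne_zero

end Summit.AtomisticToContinuum.FouriersLaw.Theorems.MourreDissolution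

end
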